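import Summits.FinalStateConjecture.FinalStateConjecture.Theses.SwallowTheDatum
import Summits.FinalStateConjecture.FinalStateConjecture.Theorems.PhaseMixingCaptureWeakCosmicCensorshipMGHDStubScriTransfer
import Summits.FinalStateConjecture.FinalStateConjecture.Theorems.SwallowTheDatumParametricKerrBurialLine
import Literature.Geometry.Lorentzian.ModelData
import Literature.Geometry.Lorentzian.KerrData
import Literature.Geometry.Lorentzian.KerrDataProofs
import Literature.Geometry.Lorentzian.KerrSchildCoord
import Literature.Geometry.Lorentzian.SchwarzschildKerrSchildRicciFlat
import Literature.Geometry.Lorentzian.InitialDataPullback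
import Literature.Geometry.Lorentzian.LeviCivitaProofs
import Literature.Geometry.Manifold.OpenSubmanifoldMFDeriv
import Summits.FinalStateConjecture.FinalStateConjecture.Theorems.SwallowTheDatumUniversalWitnessFamilyStubExteriorTransport
import Summits.FinalStateConjecture.FinalStateConjecture.Theorems.SwallowTheDatumUniversalWitnessFamilyStubDecompositionPushforward
import Summits.FinalStateConjecture.FinalStateConjecture.Theorems.SwallowTheDatumUniversalWitnessFamilyStubSheetCauchy
import Summits.FinalStateConjecture.FinalStateConjecture.Theorems.SwallowTheDatumUniversalWitnessFamilyStubSheetDataEmbedding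
import Summits.FinalStateConjecture.FinalStateConjecture.Theorems.SwallowTheDatumUniversalWitnessFamilyStubRegionOneScri
import Summits.FinalStateConjecture.FinalStateConjecture.Theorems.SwallowTheDatumUniversalWitnessFamilyRegionOneAssembly
import HarnessLib

/-!
# Crux `SwallowTheDatum.UniversalWitnessFamily` (stmt-FinalStateConjecture-10051), line `Sketch`
# (`throat-settles-too`): the reduction `MGHDExists → SubdataDevelopmentsEmbed → ThroatBurial → UWF`

The composition of the line with its six S-side stubs LANDED (`stub_sheetDataEmbedding`, `stub_sheetCauchy`,
`stub_regionOneScri`, `stub_regionOneDecomposition`, `stub_exteriorTransport`, `stub_decompositionPushforward`,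
all in `Theorems/SwallowTheDatumUniversalWitnessFamilyStub*.lean` / `…RegionOneAssembly.lean`) and the landed
lever `Theorems.PhaseMixingCapture.WeakCosmicCensorshipMGHD.stub_scriTransfer`: the crux
`UniversalWitnessFamily` follows from the route items `MGHDExists` (9937), `SubdataDevelopmentsEmbed` (10053)
and the d-side engine THROAT BURIAL (through every admissible datum passes a smooth injective admissible family
whose members off `c = 0` are throat-shielded: outside a compact set the member IS the isotropic Schwarzschild
slice `((1 + M/2‖y‖)⁴ δ, 0)` on `{‖y‖ > R₁}`, `R₁ < M/2`; = crux 9952's `ThroatBurial`, staffed on crux 10052 as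
`stub_farGluing` + `stub_bagDatum` + `stub_splice`). The throat-burial hypothesis is stated UNFOLDED (no new
definition), so that any landed `ThroatBurial` discharges it by `Iff.rfl`.

Content: §0 a membership lemma; §1 plumbing (`Kerr.Facts`, the static-slice point, the open-sheet presentation of
a throat-shielded datum); §2 `settles_core` (complete `𝓘⁺` and an exhaustive sub-extremal `N = 1` decomposition
of the self-determined exterior of ANY vacuum development into which region I embeds over the sheet),
`settlesInEveryMGHD`, and the reduction `universalWitnessFamily_of_throatBurial`.
-/


set_option linter.dupNamespace false

noncomputable section

namespace Summit.FinalStateConjecture.FinalStateConjecture.Theorems.SwallowTheDatum.UniversalWitnessFamily.ThroatSettlesToo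

open scoped Manifold ContDiff Topology
open Bundle Set Filter Function Literature.Geometry.Lorentzian
open Summit.FinalStateConjecture.FinalStateConjecture.Theses.SwallowTheDatum
  (UniversalWitnessFamily MGHDExists SubdataDevelopmentsEmbed)
open Summit.FinalStateConjecture.FinalStateConjecture.Theorems.SwallowTheDatum.ParametricKerrBurial
  (SmoothSectionsOn AgreeAt IsExactSchwarzschildBeyond IsSchwarzschildAnnulus junction)

/-! ## §0 A membership lemma -/

section ShieldVocabulary

/-- The origin does not lie in the exterior region `{‖y‖ > R₁}` for `R₁ > 0`. -/
theorem zero_notMem_exteriorRegion {R₁ : ℝ} (hR : 0 < R₁) :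
    (0 : E3) ∉ (exteriorRegion R₁ : Set E3) := by
  simp [hR.le, not_lt.mpr]

end ShieldVocabulary

/-! ## §1 Plumbing: `Kerr.Facts`, the static slice point, the open-sheet presentation -/

section Plumbing

/-- The static slice point of `y` (sheet `{‖y‖ > M/2}`) lies in the Kerr–Schild exterior `{r > 2M}`. -/
theorem sheetPoint_mem {M : ℝ} (hM : 0 < M) (y : Schwarzschild.isotropicExterior M) :
    E4.ofTimeSpace (2 * M * Real.log (‖(y : E3)‖ * (1 + M / (2 * ‖(y : E3)‖)) ^ 2 / (2 * M) - 1))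
        ((1 + M / (2 * ‖(y : E3)‖)) ^ 2 • (y : E3)) ∈ Kerr.region 0 (Kerr.rPlus M 0) := by
  have hy : M / 2 < ‖(y : E3)‖ := y.2
  rw [Kerr.mem_region, Kerr.radius_zero_left, E4.spatialNorm_ofTimeSpace, norm_smul,
    Real.norm_of_nonneg (sq_nonneg _), Kerr.rPlus_zero_right hM.le, max_eq_left (by linarith)]
  have h := two_mul_lt_arealRadius hM hy
  linarith [mul_comm (‖(y : E3)‖) ((1 + M / (2 * ‖(y : E3)‖)) ^ 2)]

variable {X : Type} [TopologicalSpace X] [ChartedSpace E3 X] [IsManifold (𝓡 3) ∞ X]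

/-- The differential of the inclusion of opens `{‖y‖ > M/2} ↪ {‖y‖ > R₁}` is the identity. -/
theorem mfderiv_inclusion_eq_id {M R₁ : ℝ} (hle : Schwarzschild.isotropicExterior M ≤ exteriorRegion R₁)
    (u : Schwarzschild.isotropicExterior M) :
    mfderiv 𝓘(ℝ, E3) 𝓘(ℝ, E3) (TopologicalSpace.Opens.inclusion hle) u = ContinuousLinearMap.id ℝ E3 := by
  set ι := TopologicalSpace.Opens.inclusion hle
  have hι : ContMDiff 𝓘(ℝ, E3) 𝓘(ℝ, E3) (∞ + 1) ι := contMDiff_inclusion hle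
  have hιd : MDifferentiableAt 𝓘(ℝ, E3) 𝓘(ℝ, E3) ι u := (hι u).mdifferentiableAt (by simp)
  have h1 : HasMFDerivAt 𝓘(ℝ, E3) 𝓘(ℝ, E3) (Subtype.val : exteriorRegion R₁ → E3) (ι u)
      (ContinuousLinearMap.id ℝ E3) := Literature.Geometry.Manifold.OpenSubmanifold.hasMFDerivAt_subtype_val (ι u)
  have h2 : HasMFDerivAt 𝓘(ℝ, E3) 𝓘(ℝ, E3) (Subtype.val : Schwarzschild.isotropicExterior M → E3) u
      (ContinuousLinearMap.id ℝ E3) := Literature.Geometry.Manifold.OpenSubmanifold.hasMFDerivAt_subtype_val u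
  have h3 : HasMFDerivAt 𝓘(ℝ, E3) 𝓘(ℝ, E3) ((Subtype.val : exteriorRegion R₁ → E3) ∘ ι) u
      ((ContinuousLinearMap.id ℝ E3).comp (mfderiv 𝓘(ℝ, E3) 𝓘(ℝ, E3) ι u)) :=
    h1.comp u hιd.hasMFDerivAt
  have hfun : ((Subtype.val : exteriorRegion R₁ → E3) ∘ ι) = Subtype.val := rfl
  rw [hfun] at h3
  have := hasMFDerivAt_unique h3 h2
  rw [ContinuousLinearMap.id_comp] at this
  exact this

/-- **The open-sheet presentation of a throat-shielded datum.**  Restricting the shielding chart of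
`IsThroatShielded X D` to the open sheet `{‖y‖ > M/2}` gives a smooth open embedding
`Φ' : isotropicExterior M → X` with injective differentials, co-compact far zones, and
`Φ'^* D = Schwarzschild.timeSymmetricExteriorData M` EXACTLY. -/
theorem sheet_presentation {D : InitialDataSet (𝓡 3) X}
    (hsh : ∃ (M R₁ : ℝ) (hM : 0 < M) (hR : 0 < R₁), R₁ < M / 2 ∧
    ∃ (Φ : exteriorRegion R₁ → X) (hΦ : ContMDiff 𝓘(ℝ, E3) (𝓡 3) (∞ + 1) Φ)
      (hΦ' : ∀ u, Function.Injective (mfderiv 𝓘(ℝ, E3) (𝓡 3) Φ u)),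
      Topology.IsOpenEmbedding Φ ∧
      (∀ R' : ℝ, IsCompact (Φ '' {y : exteriorRegion R₁ | R' < ‖(y : E3)‖})ᶜ) ∧
      D.comap Φ hΦ hΦ' =
        Schwarzschild.conformalData (M := M) (exteriorRegion R₁) hM.le (zero_notMem_exteriorRegion hR)) :
    ∃ (M : ℝ) (hM : 0 < M) (Φ' : Schwarzschild.isotropicExterior M → X)
      (hΦ' : ContMDiff (𝓡 3) (𝓡 3) (∞ + 1) Φ')
      (hΦ'' : ∀ u, Function.Injective (mfderiv (𝓡 3) (𝓡 3) Φ' u)),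
      Topology.IsOpenEmbedding Φ' ∧
      (∀ R' : ℝ, M / 2 ≤ R' →
        IsCompact (Φ' '' {y : Schwarzschild.isotropicExterior M | R' < ‖(y : E3)‖})ᶜ) ∧
      D.comap Φ' hΦ' hΦ'' = Schwarzschild.timeSymmetricExteriorData M hM.le := by
  obtain ⟨M, R₁, hM, hR, hRM, Φ, hΦ, hΦ', hopen, hfar, hexact⟩ := hsh
  have hle : Schwarzschild.isotropicExterior M ≤ exteriorRegion R₁ := fun y hy ↦
    lt_trans hRM (Schwarzschild.mem_isotropicExterior.1 hy)
  set ι := TopologicalSpace.Opens.inclusion hle with hιdef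
  have hι : ContMDiff 𝓘(ℝ, E3) 𝓘(ℝ, E3) (∞ + 1) ι := contMDiff_inclusion hle
  have hιmd : ∀ u, MDifferentiableAt 𝓘(ℝ, E3) 𝓘(ℝ, E3) ι u := fun u ↦
    (hι u).mdifferentiableAt (by simp)
  have hΦmd : ∀ z, MDifferentiableAt 𝓘(ℝ, E3) (𝓡 3) Φ z := fun z ↦
    (hΦ z).mdifferentiableAt (by simp)
  have hcomp : ∀ u, mfderiv 𝓘(ℝ, E3) (𝓡 3) (Φ ∘ ι) u = mfderiv 𝓘(ℝ, E3) (𝓡 3) Φ (ι u) := by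
    intro u
    rw [mfderiv_comp u (hΦmd (ι u)) (hιmd u), mfderiv_inclusion_eq_id hle u]
    ext v
    rfl
  have hinj : ∀ u, Function.Injective (mfderiv 𝓘(ℝ, E3) (𝓡 3) (Φ ∘ ι) u) := fun u ↦ by
    rw [hcomp u]
    exact hΦ' (ι u)
  refine ⟨M, hM, Φ ∘ ι, hΦ.comp hι, hinj, ?_, ?_, ?_⟩
  · refine hopen.comp ?_
    refine Topology.IsOpenEmbedding.inclusion hle ?_
    exact (Schwarzschild.isotropicExterior M).isOpen.preimage continuous_subtype_val
  · intro R' hR'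
    have hset : (Φ ∘ ι) '' {y : Schwarzschild.isotropicExterior M | R' < ‖(y : E3)‖} =
        Φ '' {y : exteriorRegion R₁ | R' < ‖(y : E3)‖} := by
      ext x
      simp only [Set.mem_image, Set.mem_setOf_eq, Function.comp_apply]
      constructor
      · rintro ⟨y, hy, rfl⟩
        exact ⟨ι y, hy, rfl⟩
      · rintro ⟨z, hz, rfl⟩
        have hzM : M / 2 < ‖(z : E3)‖ := lt_of_le_of_lt hR' hz
        exact ⟨⟨z, hzM⟩, hz, rfl⟩
    rw [hset]
    exact hfar R'
  · refine InitialDataSet.ext' (fun u v w ↦ ?_) (fun u v w ↦ ?_)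
    · have h1 := congrArg (fun D' : InitialDataSet 𝓘(ℝ, E3) (exteriorRegion R₁) ↦ D'.h.inner (ι u) v w) hexact
      simp only [InitialDataSet.comap_h_inner] at h1 ⊢
      rw [hcomp u]
      exact h1
    · have h1 := congrArg (fun D' : InitialDataSet 𝓘(ℝ, E3) (exteriorRegion R₁) ↦ D'.k (ι u) v w) hexact
      simp only [InitialDataSet.comap_k] at h1 ⊢
      rw [hcomp u]
      exact h1

end Plumbing

/-! ## §2 The composition -/

/-- **Core of the composition, for the open-sheet datum as a VARIABLE `D₀`** (so that the data identity
`Φ'^* D = timeSymmetricExteriorData M` is consumed by `subst`): given the specialisations to `Φ'` of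
`SubdataDevelopmentsEmbed`, of `stub_exteriorTransport` and of the landed lever `stub_scriTransfer`, the
six S-side stubs give complete `𝓘⁺` and an exhaustive sub-extremal decomposition of the self-determined
exterior of `𝒟`. -/
theorem settles_core [Kerr.Facts]
    {X : Type} [TopologicalSpace X] [ChartedSpace E3 X] [IsManifold (𝓡 3) ∞ X]
    [T2Space X] [SecondCountableTopology X] [ConnectedSpace X]
    {D : InitialDataSet (𝓡 3) X} (𝒟 : VacuumCauchyDevelopment D)
    {M : ℝ} (hM : 0 < M) {Φ' : Schwarzschild.isotropicExterior M → X}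
    (hopen : Topology.IsOpenEmbedding Φ')
    (hfar : ∀ R' : ℝ, M / 2 ≤ R' →
      IsCompact (Φ' '' {y : Schwarzschild.isotropicExterior M | R' < ‖(y : E3)‖})ᶜ)
    {D₀ : InitialDataSet (𝓡 3) (Schwarzschild.isotropicExterior M)}
    (hdata : D₀ = Schwarzschild.timeSymmetricExteriorData M hM.le)
    (hEspec : ∀ 𝒟' : VacuumCauchyDevelopment D₀, ∃ χ : 𝒟'.carrier → 𝒟.carrier,
      ContMDiff (𝓡 4) (𝓡 4) ∞ χ ∧ Topology.IsOpenEmbedding χ ∧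
        𝒟'.metric.IsIsometricImmersion 𝒟.metric.toPseudoRiemannianMetric χ ∧
          𝒟'.timeOrientation.PreservesTimeOrientation χ 𝒟.timeOrientation ∧
            χ ∘ 𝒟'.embed = 𝒟.embed ∘ Φ')
    (hT1spec : ∀ (𝒦 : CauchyDevelopment D₀) (χ : 𝒦.carrier → 𝒟.carrier),
      ContMDiff (𝓡 4) (𝓡 4) ∞ χ → Topology.IsOpenEmbedding χ →
      𝒦.metric.IsIsometricImmersion 𝒟.metric.toPseudoRiemannianMetric χ →
      𝒦.timeOrientation.PreservesTimeOrientation χ 𝒟.timeOrientation →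
      χ ∘ 𝒦.embed = 𝒟.embed ∘ Φ' →
      ∀ C : Set 𝒦.carrier,
        Summit.FinalStateConjecture.exteriorOf 𝒟.toCauchyDevelopment (χ '' C) =
          χ '' Summit.FinalStateConjecture.exteriorOf 𝒦 C)
    (hSTspec : ∀ (𝒮 : DataEmbedding D₀) (χ : 𝒮.carrier → 𝒟.carrier),
      ContMDiff (𝓡 4) (𝓡 4) ∞ χ → Topology.IsOpenEmbedding χ →
      𝒮.metric.IsIsometricImmersion 𝒟.metric.toPseudoRiemannianMetric χ →
      𝒮.timeOrientation.PreservesTimeOrientation χ 𝒟.timeOrientation →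
      χ ∘ 𝒮.embed = 𝒟.embed ∘ Φ' →
      ∀ (K : Set X), IsCompact K → Kᶜ ⊆ Set.range Φ' →
      (∀ [𝒮.metric.HasLeviCivita],
        ∃ K₀ : Set X, IsCompact K₀ ∧ ∀ s : ℝ, 0 < s → ∃ K₁ : Set X, IsCompact K₁ ∧
          ∀ p : Schwarzschild.isotropicExterior M, Φ' p ∉ K₁ → ∀ (γ : ℝ → 𝒮.carrier) (dom : Set ℝ),
            𝒮.metric.IsNormalisedNullRayFrom 𝒮.timeOrientation 𝒮.embed 𝒮.normal p γ dom →
            ¬ BddAbove dom ∨ ENNReal.ofReal s ≤ sojournTime γ dom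
              (𝒮.metric.causalFuture 𝒮.timeOrientation (𝒮.embed '' (Φ' ⁻¹' K₀)))) →
      Summit.FinalStateConjecture.HasCompleteNullInfinity 𝒟.toCauchyDevelopment) :
    Summit.FinalStateConjecture.HasCompleteNullInfinity 𝒟.toCauchyDevelopment ∧
      ∃ (O : Set 𝒟.carrier) (dec : FinalStateDecomposition 𝒟.toSpacetime O 2),
        (∀ i, Kerr.IsSubextremal (dec.mass i) (dec.spin i)) ∧
          O = Summit.FinalStateConjecture.exteriorOf 𝒟.toCauchyDevelopment dec.charted ∧
            Summit.FinalStateConjecture.HasExhaustiveCharts dec := by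
  subst hdata
  -- the explicit region-I development of the open-sheet datum
  let ψ : Schwarzschild.isotropicExterior M → Kerr.region 0 (Kerr.rPlus M 0) := fun y ↦
    ⟨E4.ofTimeSpace (2 * M * Real.log (‖(y : E3)‖ * (1 + M / (2 * ‖(y : E3)‖)) ^ 2 / (2 * M) - 1))
        ((1 + M / (2 * ‖(y : E3)‖)) ^ 2 • (y : E3)), sheetPoint_mem hM y⟩
  let ν : NormalField 𝓘(ℝ, E4) ψ := fun y ↦
    (Real.sqrt (1 - 2 * M / (‖(y : E3)‖ * (1 + M / (2 * ‖(y : E3)‖)) ^ 2)))⁻¹ • E4.basisVector 0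
  have hψ : ∀ y, (ψ y : E4) =
      E4.ofTimeSpace (2 * M * Real.log (‖(y : E3)‖ * (1 + M / (2 * ‖(y : E3)‖)) ^ 2 / (2 * M) - 1))
        ((1 + M / (2 * ‖(y : E3)‖)) ^ 2 • (y : E3)) := fun y ↦ rfl
  have hν : ∀ y, ν y = (Real.sqrt (1 - 2 * M / (‖(y : E3)‖ * (1 + M / (2 * ‖(y : E3)‖)) ^ 2)))⁻¹ •
      E4.basisVector 0 := fun y ↦ rfl
  obtain ⟨hemb, hunit, hh, hk⟩ := stub_sheetDataEmbedding M hM ψ ν hψ hν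
  have hcauchy := stub_sheetCauchy M hM ψ hψ
  let 𝒦₀ : VacuumCauchyDevelopment (Schwarzschild.timeSymmetricExteriorData M hM.le) :=
    { toSpacetime := Kerr.spacetime M 0 (Kerr.rPlus M 0) hM.le
      embed := ψ
      isSmoothEmbedding := hemb
      normal := ν
      isFutureUnitNormal := hunit
      induced_h := hh
      induced_k := by
        intro inst y
        haveI : (Kerr.smoothMetric M 0 (Kerr.rPlus M 0)).toPseudoRiemannianMetric.HasLeviCivita := inst
        exact hk y
      isCauchyHypersurface := hcauchy
      isRicciFlat := by
        intro inst
        haveI : (Kerr.smoothMetric M 0 (Kerr.rPlus M 0)).toPseudoRiemannianMetric.HasLeviCivita := inst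
        exact Kerr.isRicciFlat_smoothMetric_zero_spin M (Kerr.rPlus M 0) }
  -- exterior ignorance: 𝒦₀ embeds into the maximal 𝒟 over Φ'
  obtain ⟨χ, hχ, hχo, hiso, hτ, hcomm⟩ := hEspec 𝒦₀
  refine ⟨?_, ?_⟩
  · -- scri: the relative certificate of region I rides along χ (landed lever)
    refine hSTspec 𝒦₀.toDataEmbedding χ hχ hχo hiso hτ hcomm
      (Φ' '' {y : Schwarzschild.isotropicExterior M | M / 2 + 1 < ‖(y : E3)‖})ᶜ
      (hfar (M / 2 + 1) (by linarith)) (fun x hx ↦ ?_) ?_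
    · simp only [Set.mem_compl_iff, not_not] at hx
      obtain ⟨y, -, rfl⟩ := hx
      exact ⟨y, rfl⟩
    · intro _inst
      haveI : (Kerr.smoothMetric M 0 (Kerr.rPlus M 0)).toPseudoRiemannianMetric.HasLeviCivita := _inst
      obtain ⟨R₀, hR₀, hs⟩ := stub_regionOneScri M hM ψ ν hψ hν
      set A₀ : Set (Schwarzschild.isotropicExterior M) :=
        {y | R₀ ≤ ‖(y : E3)‖ ∧ ‖(y : E3)‖ ≤ R₀ + 1} with hA₀
      have hA₀c : IsCompact A₀ := by
        rw [Subtype.isCompact_iff]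
        have hS : (Subtype.val '' A₀ : Set E3) = {z : E3 | R₀ ≤ ‖z‖ ∧ ‖z‖ ≤ R₀ + 1} := by
          ext z
          simp only [Set.mem_image, Set.mem_setOf_eq, hA₀]
          constructor
          · rintro ⟨y, hy, rfl⟩
            exact hy
          · intro hz
            have hzM : M / 2 < ‖z‖ := lt_of_lt_of_le hR₀ hz.1
            exact ⟨⟨z, hzM⟩, hz, rfl⟩
        rw [hS]
        have hsub : {z : E3 | R₀ ≤ ‖z‖ ∧ ‖z‖ ≤ R₀ + 1} ⊆ Metric.closedBall (0 : E3) (R₀ + 1) := by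
          intro z hz
          rw [Metric.mem_closedBall, dist_zero_right]
          exact hz.2
        refine (isCompact_closedBall (0 : E3) (R₀ + 1)).of_isClosed_subset ?_ hsub
        exact (isClosed_le continuous_const continuous_norm).inter
          (isClosed_le continuous_norm continuous_const)
      refine ⟨Φ' '' A₀, hA₀c.image hopen.continuous, fun s hs0 ↦ ?_⟩
      obtain ⟨R₁, hR₁⟩ := hs s hs0
      refine ⟨(Φ' '' {y : Schwarzschild.isotropicExterior M | max R₁ (M / 2) < ‖(y : E3)‖})ᶜ,
        hfar _ (le_max_right _ _), fun p hp γ dom hγ ↦ ?_⟩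
      have hpR : R₁ < ‖(p : E3)‖ := by
        simp only [Set.mem_compl_iff, not_not] at hp
        obtain ⟨y, hy, hyp⟩ := hp
        have : y = p := hopen.injective hyp
        subst this
        exact lt_of_le_of_lt (le_max_left _ _) hy
      have hpre : Φ' ⁻¹' (Φ' '' A₀) = A₀ := hopen.injective.preimage_image A₀
      have key := hR₁ p hpR γ dom hγ
      rw [hpre]
      exact key
  · -- decomposition: the explicit region-I decomposition, pushed forward along χ
    obtain ⟨O₀, dec₀, hsub₀, hO₀, hex₀⟩ := stub_regionOneDecomposition M hM ψ hψ
    obtain ⟨dec', hsub', hch', hex'⟩ :=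
      stub_decompositionPushforward 𝒦₀.toSpacetime 𝒟.toSpacetime χ hχ hχo hiso hτ O₀ dec₀ hsub₀ hex₀
    refine ⟨χ '' O₀, dec', hsub', ?_, hex'⟩
    have h1 := hT1spec 𝒦₀.toCauchyDevelopment χ hχ hχo hiso hτ hcomm dec₀.charted
    rw [hch', h1]
    exact congrArg (fun S ↦ χ '' S) hO₀

/-- **Complete `𝓘⁺` and an exhaustive decomposition in every MGHD of a throat-shielded datum** (the content of
the planner's `ThroatShieldedSettles`), from `SubdataDevelopmentsEmbed`, the landed lever `stub_scriTransfer`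
and the six landed S-side stubs; the throat-shield is the unfolded hypothesis `hsh`. -/
theorem settlesInEveryMGHD (hE : SubdataDevelopmentsEmbed)
    (X : Type) [TopologicalSpace X] [ChartedSpace E3 X] [IsManifold (𝓡 3) ∞ X]
    [T2Space X] [SecondCountableTopology X] [ConnectedSpace X]
    (D : InitialDataSet (𝓡 3) X)
    (hsh : ∃ (M R₁ : ℝ) (hM : 0 < M) (hR : 0 < R₁), R₁ < M / 2 ∧
    ∃ (Φ : exteriorRegion R₁ → X) (hΦ : ContMDiff 𝓘(ℝ, E3) (𝓡 3) (∞ + 1) Φ)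
      (hΦ' : ∀ u, Function.Injective (mfderiv 𝓘(ℝ, E3) (𝓡 3) Φ u)),
      Topology.IsOpenEmbedding Φ ∧
      (∀ R' : ℝ, IsCompact (Φ '' {y : exteriorRegion R₁ | R' < ‖(y : E3)‖})ᶜ) ∧
      D.comap Φ hΦ hΦ' =
        Schwarzschild.conformalData (M := M) (exteriorRegion R₁) hM.le (zero_notMem_exteriorRegion hR))
    (𝒟 : VacuumCauchyDevelopment D) (hmax : 𝒟.IsMaximal) :
    Summit.FinalStateConjecture.HasCompleteNullInfinity 𝒟.toCauchyDevelopment ∧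
      ∃ (O : Set 𝒟.carrier) (dec : FinalStateDecomposition 𝒟.toSpacetime O 2),
        (∀ i, Kerr.IsSubextremal (dec.mass i) (dec.spin i)) ∧
          O = Summit.FinalStateConjecture.exteriorOf 𝒟.toCauchyDevelopment dec.charted ∧
            Summit.FinalStateConjecture.HasExhaustiveCharts dec := by
  haveI : Kerr.Facts := ⟨Kerr.isConnected_region_holds, Kerr.contMDiff_bilin_holds, Kerr.contMDiff_timeVector_holds⟩
  obtain ⟨M, hM, Φ', hΦ', hΦ'', hopen, hfar, hdata⟩ := sheet_presentation hsh
  exact settles_core 𝒟 hM hopen hfar hdata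
    (hE X D 𝒟 hmax (Schwarzschild.isotropicExterior M) Φ' hΦ' hΦ'' hopen)
    (stub_exteriorTransport X D 𝒟.toCauchyDevelopment (Schwarzschild.isotropicExterior M) Φ' hΦ' hΦ'' hopen)
    (Summit.FinalStateConjecture.FinalStateConjecture.Theorems.PhaseMixingCapture.WeakCosmicCensorshipMGHD.stub_scriTransfer
      X D 𝒟.toCauchyDevelopment (Schwarzschild.isotropicExterior M) Φ' hΦ' hΦ'' hopen)

/-- **The reduction of the crux to throat burial**: `MGHDExists → SubdataDevelopmentsEmbed → ThroatBurial →
UniversalWitnessFamily`, with THROAT BURIAL stated unfolded (through every admissible datum passes a jointly smooth,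
injective, admissible one-parameter family `F`, `F 0 = d`, whose members `F c`, `c ≠ 0`, are throat-shielded).
Pure logic after `settlesInEveryMGHD`. [cite: Christodoulou1999, p. A24] [cite: DafermosLuk2017, Conjecture 1] -/
theorem universalWitnessFamily_of_throatBurial :
    MGHDExists → SubdataDevelopmentsEmbed →
    (∀ (X : Type) [TopologicalSpace X] [ChartedSpace E3 X] [IsManifold (𝓡 3) ∞ X]
      [T2Space X] [SecondCountableTopology X] [ConnectedSpace X],
      ∀ d ∈ admissibleVacuumData X, ∃ F : EuclideanSpace ℝ (Fin 1) → InitialDataSet (𝓡 3) X,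
        InitialDataSet.IsSmoothDataFamily 1 F ∧ F 0 = d ∧ Function.Injective F ∧
        (∀ c, F c ∈ admissibleVacuumData X) ∧ ∀ c ≠ 0, ∃ (M R₁ : ℝ) (hM : 0 < M) (hR : 0 < R₁), R₁ < M / 2 ∧
        ∃ (Φ : exteriorRegion R₁ → X) (hΦ : ContMDiff 𝓘(ℝ, E3) (𝓡 3) (∞ + 1) Φ)
          (hΦ' : ∀ u, Function.Injective (mfderiv 𝓘(ℝ, E3) (𝓡 3) Φ u)),
          Topology.IsOpenEmbedding Φ ∧
          (∀ R' : ℝ, IsCompact (Φ '' {y : exteriorRegion R₁ | R' < ‖(y : E3)‖})ᶜ) ∧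
          (F c).comap Φ hΦ hΦ' =
            Schwarzschild.conformalData (M := M) (exteriorRegion R₁) hM.le (zero_notMem_exteriorRegion hR)) →
    UniversalWitnessFamily := by
  intro hM hE hB X _ _ _ _ _ _ d hd
  obtain ⟨F, hF, h0, hinj, hadm, hsh⟩ := hB X d hd
  refine ⟨F, hF, h0, hinj, hadm, fun c hc ↦ ⟨hM X (F c) (hadm c), ?_⟩⟩
  intro 𝒟 h𝒟
  exact settlesInEveryMGHD hE X (F c) (hsh c hc) 𝒟 h𝒟

end Summit.FinalStateConjecture.FinalStateConjecture.Theorems.SwallowTheDatum.UniversalWitnessFamily.ThroatSettlesToo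

end
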